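import Summits.Ventures.PercRepro.C026HubLike

/-!
# Theorem H, part 2: the two-edge hubs (H1) and (H2) (p6, gen 12)

mine-3's THEOREM H (memo §30 add. 4, INBOX 5475) for a hub `v` joined to two marks:

* **(H1)** `T = {a, b}`: `Δ_CF(G + v_{ab}) = 3·Δ_CF(G)` (`slackCF_hub2_ab`);
* **(H2)** `T = {a, c}`: `Δ_CF(G + v_{ac}) = 3·Δ_CF(G) + #{a ≁ b, b ≁ c} − #X_b` with
  `X_b = bc|a ∩ {a, b ∉ D}` (`slackCF_hub2_ac`), and `#X_b ≤ #{a ≁ b, b ≁ c}` by the closed-cluster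
  flip `Φ = kSwapInv c` (`card_Xb_le_sep`), so `Δ_CF(G + v_{ac}) ≥ 3·Δ_CF(G)` (`slackCF_hub2_ac_ge`);
  the mirror `T = {b, c}` by the `a ↔ b` symmetry of the slack (`slackCF_hub2_bc_ge`).

Proof shape (mine-3's, line by line): `Δ_CF(G + v)` is the sum over the four hub states of the slice
counts (`slackCF_hub2_eq`); each slice's events are read in `G` through the hub invariant
(`sliceCF_eq_of_hubLike`, `sliceCF_hub2`): a single open hub edge is a leaf (the slice is `G`'s),
two open hub edges join their marks, two closed hub edges join them in the closed graph; then
complement symmetry (`card_filter_compl`) and the cell bookkeeping.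
-/

namespace PercRepro

open Finset

namespace MultiGraph

/-! ### (H1): the `ab`-hub -/

section HubAB

variable {V E : Type*} [Fintype E] {G : MultiGraph V E}

omit [Fintype E] in
/-- A single open hub edge is a leaf: the joint reach through one mark adds nothing. -/
theorem conn_or_leaf (ω : Config E) (t x y : V) :
    (G.Conn ω x y ∨ (G.Conn ω x t ∧ G.Conn ω y t)) ↔ G.Conn ω x y :=
  ⟨fun h => h.elim id fun h => h.1.trans h.2.symm, Or.inl⟩

open Classical in
/-- The four slice counts of two equivalent families agree (the instances are normalised). -/
theorem card4_congr {P₁ Q₁ P₂ Q₂ P₃ Q₃ P₄ Q₄ : Config E → Prop} (h₁ : ∀ ω, P₁ ω ↔ Q₁ ω)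
    (h₂ : ∀ ω, P₂ ω ↔ Q₂ ω) (h₃ : ∀ ω, P₃ ω ↔ Q₃ ω) (h₄ : ∀ ω, P₄ ω ↔ Q₄ ω) :
    ((univ.filter P₁).card : ℤ) + ((univ.filter P₂).card : ℤ) + ((univ.filter P₃).card : ℤ) -
        ((univ.filter P₄).card : ℤ) =
      ((univ.filter Q₁).card : ℤ) + ((univ.filter Q₂).card : ℤ) + ((univ.filter Q₃).card : ℤ) -
        ((univ.filter Q₄).card : ℤ) := by
  simp only [h₁, h₂, h₃, h₄]

open Classical in
/-- The slice `(true, false)` of any two-edge hub is `Δ_CF(G)` (a leaf on each side). -/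
theorem sliceCF_hub2_tf {v t₁ t₂ a b c : V} (hv : G.Isolated v) (ht₁ : t₁ ≠ v) (ht₂ : t₂ ≠ v)
    (hav : a ≠ v) (hbv : b ≠ v) (hcv : c ≠ v) :
    (G.hub2 v t₁ t₂).sliceCF (fun ω : Config E => extendOpt false (extendOpt true ω)) a b c =
      G.slackCF a b c := by
  have key := sliceCF_eq_of_hubLike
    (R := fun ω x => (true = true ∧ G.Conn ω x t₁) ∨ (false = true ∧ G.Conn ω x t₂))
    (R' := fun ω x => ((!true) = true ∧ G.Conn ωᶜ x t₁) ∨ ((!false) = true ∧ G.Conn ωᶜ x t₂))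
    hav hbv hcv (fun ω => hubLike_hub2 hv ht₁ ht₂ ω true false) fun ω => by
      rw [compl_hub2]
      exact hubLike_hub2 hv ht₁ ht₂ ωᶜ (!true) (!false)
  rw [key]
  unfold slackCF
  simp only [Bool.not_true, Bool.not_false, Bool.false_eq_true, false_and, or_false, false_or,
    true_and, conn_or_leaf]

open Classical in
/-- The slice `(false, true)` of any two-edge hub is `Δ_CF(G)` (a leaf on each side). -/
theorem sliceCF_hub2_ft {v t₁ t₂ a b c : V} (hv : G.Isolated v) (ht₁ : t₁ ≠ v) (ht₂ : t₂ ≠ v)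
    (hav : a ≠ v) (hbv : b ≠ v) (hcv : c ≠ v) :
    (G.hub2 v t₁ t₂).sliceCF (fun ω : Config E => extendOpt true (extendOpt false ω)) a b c =
      G.slackCF a b c := by
  have key := sliceCF_eq_of_hubLike
    (R := fun ω x => (false = true ∧ G.Conn ω x t₁) ∨ (true = true ∧ G.Conn ω x t₂))
    (R' := fun ω x => ((!false) = true ∧ G.Conn ωᶜ x t₁) ∨ ((!true) = true ∧ G.Conn ωᶜ x t₂))
    hav hbv hcv (fun ω => hubLike_hub2 hv ht₁ ht₂ ω false true) fun ω => by
      rw [compl_hub2]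
      exact hubLike_hub2 hv ht₁ ht₂ ωᶜ (!false) (!true)
  rw [key]
  unfold slackCF
  simp only [Bool.not_true, Bool.not_false, Bool.false_eq_true, false_and, or_false, false_or,
    true_and, conn_or_leaf]

omit [Fintype E] in
/-- Two closed hub edges at `a, b` join them in the closed graph: the closed cluster of `c` misses
`a` and `b` in the hub graph iff it misses both in `G`. -/
theorem closed_pair_ab_iff (ω : Config E) (a b c : V) :
    (¬ (G.Conn ω c a ∨ (G.Conn ω c a ∨ G.Conn ω c b) ∧ (G.Conn ω a a ∨ G.Conn ω a b)) ∧
      ¬ (G.Conn ω c b ∨ (G.Conn ω c a ∨ G.Conn ω c b) ∧ (G.Conn ω b a ∨ G.Conn ω b b))) ↔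
      (¬ G.Conn ω c a ∧ ¬ G.Conn ω c b) := by
  have ha := Conn.refl G ω a
  have hb := Conn.refl G ω b
  tauto

omit [Fintype E] in
/-- Two open hub edges at `a, b`: `a ≁ c` in the hub graph is `c` joined to neither `a` nor `b`. -/
theorem open_pair_ab_not_ac_iff (ω : Config E) (a b c : V) :
    (¬ (G.Conn ω a c ∨ (G.Conn ω a a ∨ G.Conn ω a b) ∧ (G.Conn ω c a ∨ G.Conn ω c b))) ↔
      (¬ G.Conn ω c a ∧ ¬ G.Conn ω c b) := by
  have ha := Conn.refl G ω a
  have hac : G.Conn ω a c ↔ G.Conn ω c a := conn_comm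
  tauto

omit [Fintype E] in
/-- Two open hub edges at `a, b`: the cell `ac|b` of the hub graph is empty. -/
theorem open_pair_ab_cell_ac_iff (ω : Config E) (a b c : V) :
    ((G.Conn ω c a ∨ (G.Conn ω c a ∨ G.Conn ω c b) ∧ (G.Conn ω a a ∨ G.Conn ω a b)) ∧
      ¬ (G.Conn ω c b ∨ (G.Conn ω c a ∨ G.Conn ω c b) ∧ (G.Conn ω b a ∨ G.Conn ω b b))) ↔ False := by
  have ha := Conn.refl G ω a
  have hb := Conn.refl G ω b
  tauto

omit [Fintype E] in
/-- Two open hub edges at `a, b`: the cell `bc|a` of the hub graph is empty. -/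
theorem open_pair_ab_cell_bc_iff (ω : Config E) (a b c : V) :
    ((G.Conn ω c b ∨ (G.Conn ω c a ∨ G.Conn ω c b) ∧ (G.Conn ω b a ∨ G.Conn ω b b)) ∧
      ¬ (G.Conn ω c a ∨ (G.Conn ω c a ∨ G.Conn ω c b) ∧ (G.Conn ω a a ∨ G.Conn ω a b))) ↔ False := by
  have ha := Conn.refl G ω a
  have hb := Conn.refl G ω b
  tauto

omit [Fintype E] in
/-- Two open hub edges at `a, b`: `a ~ b` holds in the hub graph. -/
theorem open_pair_ab_conn_iff (ω : Config E) (a b : V) :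
    (G.Conn ω a b ∨ (G.Conn ω a a ∨ G.Conn ω a b) ∧ (G.Conn ω b a ∨ G.Conn ω b b)) ↔ True := by
  have ha := Conn.refl G ω a
  have hb := Conn.refl G ω b
  tauto

open Classical in
/-- The slice `(false, false)` of the `ab`-hub is `Δ_CF(G)`: the closed path `a–v–b` changes no
event. -/
theorem sliceCF_hub2_ab_ff {v a b c : V} (hv : G.Isolated v) (hav : a ≠ v) (hbv : b ≠ v)
    (hcv : c ≠ v) :
    (G.hub2 v a b).sliceCF (fun ω : Config E => extendOpt false (extendOpt false ω)) a b c =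
      G.slackCF a b c := by
  have key := sliceCF_eq_of_hubLike
    (R := fun ω x => (false = true ∧ G.Conn ω x a) ∨ (false = true ∧ G.Conn ω x b))
    (R' := fun ω x => ((!false) = true ∧ G.Conn ωᶜ x a) ∨ ((!false) = true ∧ G.Conn ωᶜ x b))
    hav hbv hcv (fun ω => hubLike_hub2 hv hav hbv ω false false) fun ω => by
      rw [compl_hub2]
      exact hubLike_hub2 hv hav hbv ωᶜ (!false) (!false)
  rw [key]
  unfold slackCF
  simp only [Bool.not_false, Bool.false_eq_true, false_and, or_false, true_and, closed_pair_ab_iff]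

open Classical in
/-- The slice `(true, true)` of the `ab`-hub vanishes: `ab|c` becomes «`c` joined to neither» and
`N_AB` becomes its closed twin, the other cells empty. -/
theorem sliceCF_hub2_ab_tt {v a b c : V} (hv : G.Isolated v) (hav : a ≠ v) (hbv : b ≠ v)
    (hcv : c ≠ v) :
    (G.hub2 v a b).sliceCF (fun ω : Config E => extendOpt true (extendOpt true ω)) a b c = 0 := by
  have key := sliceCF_eq_of_hubLike
    (R := fun ω x => (true = true ∧ G.Conn ω x a) ∨ (true = true ∧ G.Conn ω x b))
    (R' := fun ω x => ((!true) = true ∧ G.Conn ωᶜ x a) ∨ ((!true) = true ∧ G.Conn ωᶜ x b))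
    hav hbv hcv (fun ω => hubLike_hub2 hv hav hbv ω true true) fun ω => by
      rw [compl_hub2]
      exact hubLike_hub2 hv hav hbv ωᶜ (!true) (!true)
  rw [key]
  simp only [Bool.not_true, Bool.false_eq_true, false_and, or_false, true_and,
    open_pair_ab_conn_iff, open_pair_ab_not_ac_iff, open_pair_ab_cell_ac_iff,
    open_pair_ab_cell_bc_iff, Finset.filter_false, Finset.card_empty, Nat.cast_zero, add_zero]
  rw [sub_eq_zero, Nat.cast_inj]
  convert card_filter_compl (fun ω => ¬ G.Conn ω c a ∧ ¬ G.Conn ω c b) using 2 <;>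
    (ext ω; simp only [Finset.mem_filter])

open Classical in
/-- **(H1)**: `Δ_CF(G + v_{ab}) = 3·Δ_CF(G)` — the `ab`-hub triples the C-026 slack. -/
theorem slackCF_hub2_ab {v a b c : V} (hv : G.Isolated v) (hav : a ≠ v) (hbv : b ≠ v)
    (hcv : c ≠ v) : (G.hub2 v a b).slackCF a b c = 3 * G.slackCF a b c := by
  rw [slackCF_hub2_eq, sliceCF_hub2_ab_ff hv hav hbv hcv, sliceCF_hub2_tf hv hav hbv hav hbv hcv,
    sliceCF_hub2_ft hv hav hbv hav hbv hcv, sliceCF_hub2_ab_tt hv hav hbv hcv]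
  ring

end HubAB

/-! ### (H2): the `ac`-hub -/

section HubAC

variable {V E : Type*} [Fintype E] {G : MultiGraph V E}

omit [Fintype E] in
/-- Two closed hub edges at `a, c` put `a` into the closed cluster of `c`: `N_AB` is empty. -/
theorem closed_pair_ac_iff (ω : Config E) (a b c : V) :
    (¬ (G.Conn ω c a ∨ (G.Conn ω c a ∨ G.Conn ω c c) ∧ (G.Conn ω a a ∨ G.Conn ω a c)) ∧
      ¬ (G.Conn ω c b ∨ (G.Conn ω c a ∨ G.Conn ω c c) ∧ (G.Conn ω b a ∨ G.Conn ω b c))) ↔ False := by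
  have ha := Conn.refl G ω a
  have hc := Conn.refl G ω c
  tauto

omit [Fintype E] in
/-- Two open hub edges at `a, c` join `a` and `c`. -/
theorem open_pair_ac_not_ac_iff (ω : Config E) (a c : V) :
    (¬ (G.Conn ω a c ∨ (G.Conn ω a a ∨ G.Conn ω a c) ∧ (G.Conn ω c a ∨ G.Conn ω c c))) ↔ False := by
  have ha := Conn.refl G ω a
  have hc := Conn.refl G ω c
  tauto

omit [Fintype E] in
/-- Two open hub edges at `a, c` join `c` and `a`. -/
theorem open_pair_ac_not_ca_iff (ω : Config E) (a c : V) :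
    (¬ (G.Conn ω c a ∨ (G.Conn ω c a ∨ G.Conn ω c c) ∧ (G.Conn ω a a ∨ G.Conn ω a c))) ↔ False := by
  have ha := Conn.refl G ω a
  have hc := Conn.refl G ω c
  tauto

omit [Fintype E] in
/-- Two open hub edges at `a, c`: the cell `ac|b` of the hub graph is `a ≁ b ∧ b ≁ c` in `G`. -/
theorem open_pair_ac_cell_ac_iff (ω : Config E) (a b c : V) :
    ((G.Conn ω c a ∨ (G.Conn ω c a ∨ G.Conn ω c c) ∧ (G.Conn ω a a ∨ G.Conn ω a c)) ∧
      ¬ (G.Conn ω c b ∨ (G.Conn ω c a ∨ G.Conn ω c c) ∧ (G.Conn ω b a ∨ G.Conn ω b c))) ↔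
      (¬ G.Conn ω a b ∧ ¬ G.Conn ω b c) := by
  have ha := Conn.refl G ω a
  have hc := Conn.refl G ω c
  have hba : G.Conn ω b a ↔ G.Conn ω a b := conn_comm
  have hcb : G.Conn ω c b ↔ G.Conn ω b c := conn_comm
  tauto

omit [Fintype E] in
/-- Two open hub edges at `a, c`: `a ~ b` in the hub graph is `a ~ b ∨ c ~ b` in `G`. -/
theorem open_pair_ac_conn_ab_iff (ω : Config E) (a b c : V) :
    (G.Conn ω a b ∨ (G.Conn ω a a ∨ G.Conn ω a c) ∧ (G.Conn ω b a ∨ G.Conn ω b c)) ↔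
      (G.Conn ω a b ∨ G.Conn ω c b) := by
  have ha := Conn.refl G ω a
  have hba : G.Conn ω b a ↔ G.Conn ω a b := conn_comm
  have hbc : G.Conn ω b c ↔ G.Conn ω c b := conn_comm
  tauto

open Classical in
/-- The slice `(false, false)` of the `ac`-hub: the three cells of `G`, no `N_AB`. -/
theorem sliceCF_hub2_ac_ff {v a b c : V} (hv : G.Isolated v) (hav : a ≠ v) (hbv : b ≠ v)
    (hcv : c ≠ v) :
    (G.hub2 v a c).sliceCF (fun ω : Config E => extendOpt false (extendOpt false ω)) a b c =
      ((univ.filter fun ω : Config E => G.Conn ω a b ∧ ¬ G.Conn ω a c).card : ℤ) +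
        ((univ.filter fun ω : Config E => G.Conn ω c a ∧ ¬ G.Conn ω c b).card : ℤ) +
        ((univ.filter fun ω : Config E => G.Conn ω c b ∧ ¬ G.Conn ω c a).card : ℤ) := by
  have key := sliceCF_eq_of_hubLike
    (R := fun ω x => (false = true ∧ G.Conn ω x a) ∨ (false = true ∧ G.Conn ω x c))
    (R' := fun ω x => ((!false) = true ∧ G.Conn ωᶜ x a) ∨ ((!false) = true ∧ G.Conn ωᶜ x c))
    hav hbv hcv (fun ω => hubLike_hub2 hv hav hcv ω false false) fun ω => by
      rw [compl_hub2]
      exact hubLike_hub2 hv hav hcv ωᶜ (!false) (!false)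
  rw [key]
  simp only [Bool.not_false, Bool.false_eq_true, false_and, or_false, true_and, closed_pair_ac_iff,
    and_false, Finset.filter_false, Finset.card_empty, Nat.cast_zero, sub_zero]

open Classical in
/-- The slice `(true, true)` of the `ac`-hub: `ac|b` becomes `{a ≁ b, b ≁ c}`, `N_AB` becomes
`{a ~ b ∨ c ~ b} ∩ Λ`, the other cells empty. -/
theorem sliceCF_hub2_ac_tt {v a b c : V} (hv : G.Isolated v) (hav : a ≠ v) (hbv : b ≠ v)
    (hcv : c ≠ v) :
    (G.hub2 v a c).sliceCF (fun ω : Config E => extendOpt true (extendOpt true ω)) a b c =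
      ((univ.filter fun ω : Config E => ¬ G.Conn ω a b ∧ ¬ G.Conn ω b c).card : ℤ) -
        ((univ.filter fun ω : Config E =>
          (G.Conn ω a b ∨ G.Conn ω c b) ∧ ¬ G.Conn ωᶜ c a ∧ ¬ G.Conn ωᶜ c b).card : ℤ) := by
  have key := sliceCF_eq_of_hubLike
    (R := fun ω x => (true = true ∧ G.Conn ω x a) ∨ (true = true ∧ G.Conn ω x c))
    (R' := fun ω x => ((!true) = true ∧ G.Conn ωᶜ x a) ∨ ((!true) = true ∧ G.Conn ωᶜ x c))
    hav hbv hcv (fun ω => hubLike_hub2 hv hav hcv ω true true) fun ω => by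
      rw [compl_hub2]
      exact hubLike_hub2 hv hav hcv ωᶜ (!true) (!true)
  rw [key]
  simp only [Bool.not_true, Bool.false_eq_true, false_and, or_false, true_and]
  simp only [open_pair_ac_not_ac_iff (a := a) (c := c), open_pair_ac_not_ca_iff (a := a) (c := c),
    and_false, Finset.filter_false, Finset.card_empty, Nat.cast_zero, add_zero, zero_add]
  simp only [open_pair_ac_cell_ac_iff (a := a) (b := b) (c := c),
    open_pair_ac_conn_ab_iff (a := a) (b := b) (c := c)]

omit [Fintype E] in
/-- On `c ~ b`, `a ~ b` and `c ~ a` agree. -/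
theorem conn_ab_iff_ca_of_cb {ω : Config E} {a b c : V} (hcb : G.Conn ω c b) :
    G.Conn ω a b ↔ G.Conn ω c a :=
  ⟨fun h => hcb.trans h.symm, fun h => h.symm.trans hcb⟩

open Classical in
/-- **`#{a ~ b ∨ c ~ b} ∩ Λ = #N_AB + #X_b`** (`X_b = bc|a ∩ Λ`). -/
theorem card_nAB_or_cb_eq (a b c : V) :
    (univ.filter fun ω : Config E =>
        (G.Conn ω a b ∨ G.Conn ω c b) ∧ ¬ G.Conn ωᶜ c a ∧ ¬ G.Conn ωᶜ c b).card =
      (univ.filter fun ω : Config E => G.Conn ω a b ∧ ¬ G.Conn ωᶜ c a ∧ ¬ G.Conn ωᶜ c b).card +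
        (univ.filter fun ω : Config E =>
          G.Conn ω c b ∧ ¬ G.Conn ω c a ∧ ¬ G.Conn ωᶜ c a ∧ ¬ G.Conn ωᶜ c b).card := by
  rw [Finset.card_filter, Finset.card_filter, Finset.card_filter, ← Finset.sum_add_distrib]
  refine Finset.sum_congr rfl fun ω _ => ?_
  by_cases hcb : G.Conn ω c b
  · have hiff := conn_ab_iff_ca_of_cb (G := G) (a := a) hcb
    by_cases hab : G.Conn ω a b
    · have hca := hiff.mp hab
      simp [hab, hcb, hca]
    · have hca : ¬ G.Conn ω c a := fun h => hab (hiff.mpr h)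
      simp [hab, hcb, hca]
  · simp [hcb]

open Classical in
/-- **(H2)**: `Δ_CF(G + v_{ac}) = 3·Δ_CF(G) + #{a ≁ b, b ≁ c} − #X_b`. -/
theorem slackCF_hub2_ac {v a b c : V} (hv : G.Isolated v) (hav : a ≠ v) (hbv : b ≠ v)
    (hcv : c ≠ v) :
    (G.hub2 v a c).slackCF a b c =
      3 * G.slackCF a b c +
        ((univ.filter fun ω : Config E => ¬ G.Conn ω a b ∧ ¬ G.Conn ω b c).card : ℤ) -
        ((univ.filter fun ω : Config E =>
          G.Conn ω c b ∧ ¬ G.Conn ω c a ∧ ¬ G.Conn ωᶜ c a ∧ ¬ G.Conn ωᶜ c b).card : ℤ) := by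
  rw [slackCF_hub2_eq, sliceCF_hub2_ac_ff hv hav hbv hcv, sliceCF_hub2_tf hv hav hcv hav hbv hcv,
    sliceCF_hub2_ft hv hav hcv hav hbv hcv, sliceCF_hub2_ac_tt hv hav hbv hcv, card_nAB_or_cb_eq]
  have hs : G.slackCF a b c =
      ((univ.filter fun ω : Config E => G.Conn ω a b ∧ ¬ G.Conn ω a c).card : ℤ) +
        ((univ.filter fun ω : Config E => G.Conn ω c a ∧ ¬ G.Conn ω c b).card : ℤ) +
        ((univ.filter fun ω : Config E => G.Conn ω c b ∧ ¬ G.Conn ω c a).card : ℤ) -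
        ((univ.filter fun ω : Config E =>
          G.Conn ω a b ∧ ¬ G.Conn ωᶜ c a ∧ ¬ G.Conn ωᶜ c b).card : ℤ) := by
    unfold slackCF
    rfl
  rw [hs]
  push_cast
  ring

open Classical in
/-- **`Φ` injects `X_b` into `{a ≁ b, b ≁ c}`**: the closed-cluster flip seals `D`, so `c` reaches
neither mark and an open `a–b` path would already exist in `S`. -/
theorem card_Xb_le_sep (a b c : V) :
    (univ.filter fun ω : Config E =>
        G.Conn ω c b ∧ ¬ G.Conn ω c a ∧ ¬ G.Conn ωᶜ c a ∧ ¬ G.Conn ωᶜ c b).card ≤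
      (univ.filter fun ω : Config E => ¬ G.Conn ω a b ∧ ¬ G.Conn ω b c).card := by
  refine Finset.card_le_card_of_injOn (G.kSwapInv c) ?_ (kSwapInv_injective c).injOn
  intro ω hω
  simp only [Finset.coe_filter, Finset.mem_univ, true_and, Set.mem_setOf_eq] at hω ⊢
  obtain ⟨hcb, hca, hca', hcb'⟩ := hω
  refine ⟨fun h => ?_, fun h => ?_⟩
  · exact hca (hcb.trans (conn_kSwapInv_of_not_conn_compl hca' h).2.symm)
  · exact hcb' ((conn_kSwapInv_iff c b ω).mp h.symm)

/-- **(H2), the inequality**: `3·Δ_CF(G) ≤ Δ_CF(G + v_{ac})`. -/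
theorem slackCF_hub2_ac_ge {v a b c : V} (hv : G.Isolated v) (hav : a ≠ v) (hbv : b ≠ v)
    (hcv : c ≠ v) : 3 * G.slackCF a b c ≤ (G.hub2 v a c).slackCF a b c := by
  rw [slackCF_hub2_ac hv hav hbv hcv]
  have := card_Xb_le_sep (G := G) a b c
  omega

open Classical in
/-- The C-026 slack is symmetric in the marks `a, b`. -/
theorem slackCF_comm (a b c : V) : G.slackCF a b c = G.slackCF b a c := by
  unfold slackCF
  have h1 : ∀ ω : Config E, (G.Conn ω a b ∧ ¬ G.Conn ω a c) ↔ (G.Conn ω b a ∧ ¬ G.Conn ω b c) :=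
    fun ω => ⟨fun h => ⟨h.1.symm, fun hbc => h.2 (h.1.trans hbc)⟩,
      fun h => ⟨h.1.symm, fun hac => h.2 (h.1.trans hac)⟩⟩
  have h2 : ∀ ω : Config E, (G.Conn ω a b ∧ ¬ G.Conn ωᶜ c a ∧ ¬ G.Conn ωᶜ c b) ↔
      (G.Conn ω b a ∧ ¬ G.Conn ωᶜ c b ∧ ¬ G.Conn ωᶜ c a) :=
    fun ω => ⟨fun h => ⟨h.1.symm, h.2.2, h.2.1⟩, fun h => ⟨h.1.symm, h.2.2, h.2.1⟩⟩
  simp only [h1, h2]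
  ring

/-- **(H2), mirror**: `3·Δ_CF(G) ≤ Δ_CF(G + v_{bc})`. -/
theorem slackCF_hub2_bc_ge {v a b c : V} (hv : G.Isolated v) (hav : a ≠ v) (hbv : b ≠ v)
    (hcv : c ≠ v) : 3 * G.slackCF a b c ≤ (G.hub2 v b c).slackCF a b c := by
  rw [slackCF_comm, (G.hub2 v b c).slackCF_comm]
  exact slackCF_hub2_ac_ge hv hbv hav hcv

/-- **Corollary H for two-edge hubs**: (CF) on `G` gives (CF) on `G` plus a hub of type `ab`, `ac`
or `bc`. -/
theorem slackCF_nonneg_hub2_ab {v a b c : V} (hv : G.Isolated v) (hav : a ≠ v) (hbv : b ≠ v)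
    (hcv : c ≠ v) (h : 0 ≤ G.slackCF a b c) : 0 ≤ (G.hub2 v a b).slackCF a b c := by
  rw [slackCF_hub2_ab hv hav hbv hcv]
  omega

/-- (CF) on `G` gives (CF) on `G + v_{ac}`. -/
theorem slackCF_nonneg_hub2_ac {v a b c : V} (hv : G.Isolated v) (hav : a ≠ v) (hbv : b ≠ v)
    (hcv : c ≠ v) (h : 0 ≤ G.slackCF a b c) : 0 ≤ (G.hub2 v a c).slackCF a b c :=
  le_trans (by omega) (slackCF_hub2_ac_ge hv hav hbv hcv)

/-- (CF) on `G` gives (CF) on `G + v_{bc}`. -/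
theorem slackCF_nonneg_hub2_bc {v a b c : V} (hv : G.Isolated v) (hav : a ≠ v) (hbv : b ≠ v)
    (hcv : c ≠ v) (h : 0 ≤ G.slackCF a b c) : 0 ≤ (G.hub2 v b c).slackCF a b c :=
  le_trans (by omega) (slackCF_hub2_bc_ge hv hav hbv hcv)

end HubAC

end MultiGraph

end PercRepro
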